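import Mathlib
import Literature.AlgebraicGeometry.Resolution.QuadraticTransformsFactorization
import HarnessLib

/-!
# Route `RadicialJung`, crux `CleanModels` (stmt-15917), stub `stub_cleanLU3DefectNonDiscrete`, sub-line (C-div): CHART PRELIMINARIES
# for `stub_persistCases` (workfile `Lines/Sketch_Cdiv_assembly.lean` v3, §PersistV3)

Lead `res-B-lead-1` g5.  OURS; nothing here proves resolution in characteristic `p`.

One quadratic transform `S ⊂ S'` of a two-dimensional regular local ring `S ⊆ κ` along a valuation ring `Ō` dominating `S`, read in a
GIVEN regular system of parameters `(σ, τ)` of `S` with `v(τ) ≥ v(σ)` (`σ` of minimal value):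
* `exists_max_valuation_gen` — one of the two generators has the minimal value of `𝔪_S`;
* `qt_eq_locAtCentre_adjoin` — `S' = (S[τ/σ])_{𝔪_Ō ∩ S[τ/σ]}` (uniqueness of the transform along `Ō`);
* `div_mem_qt` — `τ/σ ∈ S'`, and `z/σ ∈ S'` for every `z ∈ 𝔪_S`;
* `isUnit_qt_iff` / `mem_maximalIdeal_qt_iff` — units / non-units of `S'` by value;
* `exists_maximalIdeal_qt_eq_span` — `𝔪_{S'} = (σ, f)` for some `f`;
* `maximalIdeal_qt_eq_span_of_lt` — if `v(τ/σ) > 0` then `𝔪_{S'} = (σ, τ/σ)`.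
-/

noncomputable section

set_option linter.dupNamespace false -- mandated namespace of this single-conjunct summit

open IsLocalRing Polynomial
open Literature.AlgebraicGeometry.Resolution

namespace Summit.ResolutionOfSingularities.ResolutionOfSingularities.Theorems.RadicialJung.CleanModels

variable {κ : Type} [Field κ]

/-- In a local subring `S ⊆ Ō` with `𝔪_S = (x, y)`, one of `x, y` has the minimal value of `𝔪_S` (i.e. the maximal `Ō.valuation`).
[folklore] -/
theorem exists_max_valuation_gen (Ō : ValuationSubring κ) (S : Subring κ) [IsLocalRing S] (hSŌ : S ≤ Ō.toSubring)
    (x y : S) (hm : maximalIdeal S = Ideal.span {x, y}) :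
    (∀ z ∈ maximalIdeal S, Ō.valuation (z : κ) ≤ Ō.valuation (x : κ)) ∨
    (∀ z ∈ maximalIdeal S, Ō.valuation (z : κ) ≤ Ō.valuation (y : κ)) := by
  have key : ∀ (a b : S), maximalIdeal S = Ideal.span {a, b} → Ō.valuation (b : κ) ≤ Ō.valuation (a : κ) →
      ∀ z ∈ maximalIdeal S, Ō.valuation (z : κ) ≤ Ō.valuation (a : κ) := by
    intro a b hab hba z hz
    rw [hab] at hz
    obtain ⟨c, d, rfl⟩ := Ideal.mem_span_pair.mp hz
    have hc : Ō.valuation (c : κ) ≤ 1 := (Ō.valuation_le_one_iff _).mpr (hSŌ c.2)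
    have hd : Ō.valuation (d : κ) ≤ 1 := (Ō.valuation_le_one_iff _).mpr (hSŌ d.2)
    push_cast
    refine (Valuation.map_add _ _ _).trans (max_le ?_ ?_)
    · rw [map_mul]
      calc Ō.valuation (c : κ) * Ō.valuation (a : κ) ≤ 1 * Ō.valuation (a : κ) := mul_le_mul' hc le_rfl
        _ = _ := one_mul _
    · rw [map_mul]
      calc Ō.valuation (d : κ) * Ō.valuation (b : κ) ≤ 1 * Ō.valuation (a : κ) := mul_le_mul' hd hba
        _ = _ := one_mul _
  rcases le_total (Ō.valuation (y : κ)) (Ō.valuation (x : κ)) with h | h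
  · exact Or.inl (key x y hm h)
  · exact Or.inr (key y x (by rw [hm, Set.pair_comm]) h)

section Units

variable {Ō : ValuationSubring κ} {S S' : Subring κ}

/-- Units of `S'` are the elements of value `1` (`Ō` dominates `S'`). [folklore] -/
theorem isUnit_qt_iff (hqt : IsQuadraticTransformAlong Ō S S') (z : S') :
    IsUnit z ↔ Ō.valuation (z : κ) = 1 := by
  haveI := hqt.isLocalRing
  have h := (subringDominates_valuationSubring_iff hqt.target_le).mp hqt.dominated z
  have hle : Ō.valuation (z : κ) ≤ 1 := (Ō.valuation_le_one_iff _).mpr (hqt.target_le z.2)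
  constructor
  · intro hu
    by_contra hne
    exact (IsLocalRing.mem_maximalIdeal _ |>.mp (h.mpr (lt_of_le_of_ne hle hne))) hu
  · intro h1
    by_contra hnu
    have := h.mp ((IsLocalRing.mem_maximalIdeal _).mpr hnu)
    exact absurd h1 (ne_of_lt this)

/-- Non-units of `S'` are the elements of value `< 1`. [folklore] -/
theorem mem_maximalIdeal_qt_iff (hqt : IsQuadraticTransformAlong Ō S S') (z : S') :
    (haveI := hqt.isLocalRing; z ∈ maximalIdeal S') ↔ Ō.valuation (z : κ) < 1 := by
  haveI := hqt.isLocalRing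
  exact (subringDominates_valuationSubring_iff hqt.target_le).mp hqt.dominated z

/-- Non-units of `S` are the elements of value `< 1` when `Ō` dominates `S`. [folklore] -/
theorem mem_maximalIdeal_iff_of_dominates {S : Subring κ} [IsLocalRing S] (hdom : SubringDominates S Ō.toSubring) (z : S) :
    z ∈ maximalIdeal S ↔ Ō.valuation (z : κ) < 1 :=
  (subringDominates_valuationSubring_iff hdom.1).mp hdom z

/-- Units of `S` are the elements of value `1` when `Ō` dominates `S`. [folklore] -/
theorem isUnit_iff_of_dominates {S : Subring κ} [IsLocalRing S] (hdom : SubringDominates S Ō.toSubring) (z : S) :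
    IsUnit z ↔ Ō.valuation (z : κ) = 1 := by
  have h := mem_maximalIdeal_iff_of_dominates hdom z
  have hle : Ō.valuation (z : κ) ≤ 1 := (Ō.valuation_le_one_iff _).mpr (hdom.1 z.2)
  constructor
  · intro hu
    by_contra hne
    exact (IsLocalRing.mem_maximalIdeal _ |>.mp (h.mpr (lt_of_le_of_ne hle hne))) hu
  · intro h1
    by_contra hnu
    have := h.mp ((IsLocalRing.mem_maximalIdeal _).mpr hnu)
    exact absurd h1 (ne_of_lt this)

/-- A unit of `S` stays a unit in `S' ⊇ S`. [folklore] -/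
theorem isUnit_qt_of_isUnit (hqt : IsQuadraticTransformAlong Ō S S') {ε : S} (hε : IsUnit ε) :
    IsUnit (⟨(ε : κ), hqt.le ε.2⟩ : S') := by
  rw [isUnit_subring_iff_inv_mem] at hε ⊢
  exact ⟨hε.1, hqt.le hε.2⟩

end Units

section Chart

variable (Ō : ValuationSubring κ) (S S' : Subring κ) [IsLocalRing S]

/-- **The quadratic transform along `Ō` in the chart of a chosen generator of minimal value**: if `𝔪_S = (σ, τ)` with
`v(τ) ≥ v(σ)`, then `S' = (S[τ/σ])_{𝔪_Ō ∩ S[τ/σ]}`. [folklore] -/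
theorem qt_eq_locAtCentre_adjoin (hqt : IsQuadraticTransformAlong Ō S S')
    (σ τ : S) (hm : maximalIdeal S = Ideal.span {σ, τ})
    (hmax : ∀ z ∈ maximalIdeal S, Ō.valuation (z : κ) ≤ Ō.valuation (σ : κ)) :
    S' = locAtCentre (Algebra.adjoin S {((τ : S) : κ) / (σ : κ)}).toSubring Ō := by
  classical
  have hSŌ : S ≤ Ō.toSubring := hqt.source_le
  have hσm : σ ∈ maximalIdeal S := by rw [hm]; exact Ideal.subset_span (by simp)
  have hσ0 : σ ≠ 0 := by
    intro h
    -- `𝔪_S = (0, τ) = (τ)` would make `S` regular of dimension `≤ 1`; but then `τ = 0` too?  Use: `σ = 0` forces every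
    -- `z ∈ 𝔪_S` to have value `≤ v(0) = 0`, i.e. `𝔪_S = 0`, so `S` is a field, contradicting `finrank 𝔪/𝔪² = dim ≥ ...`;
    -- simplest: the quadratic transform datum itself provides a NONZERO generator of minimal value.
    obtain ⟨_, x, hxm, hx0, hxmax, -⟩ := hqt.exists_eq_locAtCentre
    have h1 := hmax x hxm
    rw [h, ZeroMemClass.coe_zero, map_zero, le_zero_iff, map_eq_zero] at h1
    exact hx0 (Subtype.ext h1)
  -- a finite generating set of `𝔪_S` containing `σ`
  let u : Finset S := {σ, τ}
  have hu : Ideal.span (u : Set S) = maximalIdeal S := by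
    rw [hm]; simp [u]
  have hqt' : IsQuadraticTransformAlong Ō S (locAtCentre (blowupRing S (σ : κ)) Ō) := by
    refine ⟨inferInstance, hSŌ, u, σ, hu, by simp [u], hσ0, fun z hz => hmax z (hu ▸ Ideal.subset_span hz), ?_⟩
    rw [blowupRing_eq_closure_of_span_eq (σ : κ) (u : Set S) hu]
  rw [hqt.unique hqt', blowupRing_eq_adjoin hm]

variable {Ō S S'}

/-- `z/σ ∈ S'` for `z ∈ 𝔪_S` and `σ` a generator of minimal value. [folklore] -/
theorem div_mem_qt (hqt : IsQuadraticTransformAlong Ō S S')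
    (σ τ : S) (hm : maximalIdeal S = Ideal.span {σ, τ})
    (hmax : ∀ z ∈ maximalIdeal S, Ō.valuation (z : κ) ≤ Ō.valuation (σ : κ))
    {z : S} (hz : z ∈ maximalIdeal S) : (z : κ) / (σ : κ) ∈ S' := by
  have h := div_mem_blowupRing (σ : κ) hz
  rw [blowupRing_eq_adjoin hm] at h
  rw [qt_eq_locAtCentre_adjoin Ō S S' hqt σ τ hm hmax]
  exact le_locAtCentre _ Ō h

/-- In particular `τ/σ ∈ S'`. [folklore] -/
theorem ratio_mem_qt (hqt : IsQuadraticTransformAlong Ō S S')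
    (σ τ : S) (hm : maximalIdeal S = Ideal.span {σ, τ})
    (hmax : ∀ z ∈ maximalIdeal S, Ō.valuation (z : κ) ≤ Ō.valuation (σ : κ)) :
    ((τ : S) : κ) / (σ : κ) ∈ S' :=
  div_mem_qt hqt σ τ hm hmax (by rw [hm]; exact Ideal.subset_span (by simp))

/-- `σ ∈ S'` is a non-unit of `S'`, and `σ ≠ 0`. [folklore] -/
theorem gen_mem_maximalIdeal_qt (hqt : IsQuadraticTransformAlong Ō S S') (hdom : SubringDominates S Ō.toSubring)
    (σ τ : S) (hm : maximalIdeal S = Ideal.span {σ, τ}) :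
    (haveI := hqt.isLocalRing; (⟨(σ : κ), hqt.le σ.2⟩ : S') ∈ maximalIdeal S') := by
  haveI := hqt.isLocalRing
  rw [mem_maximalIdeal_qt_iff hqt]
  have hσm : σ ∈ maximalIdeal S := by rw [hm]; exact Ideal.subset_span (by simp)
  exact (mem_maximalIdeal_iff_of_dominates hdom σ).mp hσm

/-- **The maximal ideal of the transform needs `σ` and one more generator**: `𝔪_{S'} = (σ, f)`.  (The centre of `Ō` on `S[τ/σ]`
contains the exceptional prime `σ S[τ/σ]`, and `S[τ/σ]/(σ) ≅ κ(S)[X]` is a PID — ✓ `exists_eq_span_pair_of_map_maximalIdeal_le`.)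
[folklore] -/
theorem exists_maximalIdeal_qt_eq_span (hqt : IsQuadraticTransformAlong Ō S S') (hdom : SubringDominates S Ō.toSubring)
    (σ τ : S) (hm : maximalIdeal S = Ideal.span {σ, τ})
    (hmax : ∀ z ∈ maximalIdeal S, Ō.valuation (z : κ) ≤ Ō.valuation (σ : κ)) :
    ∃ f : S', (haveI := hqt.isLocalRing; maximalIdeal S') = Ideal.span {⟨(σ : κ), hqt.le σ.2⟩, f} := by
  classical
  haveI := hqt.isLocalRing
  have hS' := qt_eq_locAtCentre_adjoin Ō S S' hqt σ τ hm hmax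
  set u : κ := ((τ : S) : κ) / (σ : κ) with hu
  set A : Subring κ := (Algebra.adjoin S {u}).toSubring with hA
  have hAS' : A ≤ S' := by rw [hS']; exact le_locAtCentre _ Ō
  have hAŌ : A ≤ Ō.toSubring := hAS'.trans hqt.target_le
  have hσ0 : σ ≠ 0 := by
    intro h
    obtain ⟨_, x, hxm, hx0, -, -⟩ := hqt.exists_eq_locAtCentre
    have h1 := hmax x hxm
    rw [h, ZeroMemClass.coe_zero, map_zero, le_zero_iff, map_eq_zero] at h1
    exact hx0 (Subtype.ext h1)
  -- the centre of `Ō` on `A`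
  set Q : Ideal A := subringCentre A Ō hAŌ with hQ
  have hQm : (maximalIdeal S).map (Subring.inclusion (subring_le_adjoin S u)) ≤ Q := by
    rw [Ideal.map_le_iff_le_comap]
    intro m hmm
    rw [Ideal.mem_comap, hQ, mem_subringCentre_iff]
    exact (mem_maximalIdeal_iff_of_dominates hdom m).mp hmm
  obtain ⟨f, hQf⟩ := exists_eq_span_pair_of_map_maximalIdeal_le hm hσ0 hu hQm
  -- transport to `S' = A_Q`
  subst hS'
  haveI := isLocalization_locAtCentre hAŌ
  refine ⟨algebraMap A _ f, ?_⟩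
  have e : Q.map (algebraMap A (locAtCentre A Ō)) =
      (Ideal.span {Subring.inclusion (subring_le_adjoin S u) σ, f}).map (algebraMap A (locAtCentre A Ō)) :=
    congrArg (Ideal.map (algebraMap A (locAtCentre A Ō))) hQf
  rw [← IsLocalization.AtPrime.map_eq_maximalIdeal Q (locAtCentre A Ō), e, Ideal.map_span, Set.image_insert_eq,
    Set.image_singleton]
  rfl

/-- **Origin of the chart**: if moreover `v(τ/σ) > 0`, then `𝔪_{S'} = (σ, τ/σ)`.  (An element of the centre `Q` of `Ō` on `S[τ/σ]`
is `P(τ/σ)` with `P(0) ∈ 𝔪_S = (σ, σ·(τ/σ))`.) [folklore] -/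
theorem maximalIdeal_qt_eq_span_of_lt (hqt : IsQuadraticTransformAlong Ō S S') (hdom : SubringDominates S Ō.toSubring)
    (σ τ : S) (hm : maximalIdeal S = Ideal.span {σ, τ})
    (hmax : ∀ z ∈ maximalIdeal S, Ō.valuation (z : κ) ≤ Ō.valuation (σ : κ))
    (hlt : Ō.valuation (((τ : S) : κ) / (σ : κ)) < 1) :
    (haveI := hqt.isLocalRing; maximalIdeal S') =
      Ideal.span {⟨(σ : κ), hqt.le σ.2⟩, ⟨((τ : S) : κ) / (σ : κ), ratio_mem_qt hqt σ τ hm hmax⟩} := by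
  classical
  haveI := hqt.isLocalRing
  have hwS' := ratio_mem_qt hqt σ τ hm hmax
  have hS' := qt_eq_locAtCentre_adjoin Ō S S' hqt σ τ hm hmax
  set u : κ := ((τ : S) : κ) / (σ : κ) with hu
  set A : Subring κ := (Algebra.adjoin S {u}).toSubring with hA
  have hAS' : A ≤ S' := by rw [hS']; exact le_locAtCentre _ Ō
  have hSS' : S ≤ S' := hqt.le
  have hσ0 : (σ : κ) ≠ 0 := by
    intro h
    obtain ⟨_, x, hxm, hx0, -, -⟩ := hqt.exists_eq_locAtCentre
    have h1 := hmax x hxm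
    rw [h, map_zero, le_zero_iff, map_eq_zero] at h1
    exact hx0 (Subtype.ext h1)
  set σ' : S' := ⟨(σ : κ), hqt.le σ.2⟩ with hσ'
  set w' : S' := ⟨u, hwS'⟩ with hw'
  have hw'm : w' ∈ maximalIdeal S' := (mem_maximalIdeal_qt_iff hqt w').mpr hlt
  have hσ'm : σ' ∈ maximalIdeal S' := gen_mem_maximalIdeal_qt hqt hdom σ τ hm
  apply le_antisymm
  · intro z hz
    -- `z = a / b`, `a, b ∈ A`, `v b = 1`
    have hzS' : (z : κ) ∈ locAtCentre A Ō := by rw [← hS']; exact z.2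
    obtain ⟨a, ha, b, hb, hvb, hzab⟩ := (mem_locAtCentre_iff).mp hzS'
    have hb0 : b ≠ 0 := ne_zero_of_valuation_eq_one hvb
    have hbS' : b ∈ S' := hAS' hb
    have hbu : IsUnit (⟨b, hbS'⟩ : S') := (isUnit_qt_iff hqt _).mpr hvb
    -- `a = P(u)`, `P = C P₀ + X * P'`
    obtain ⟨P, hPa⟩ := exists_aeval_eq_of_mem_adjoin ha
    have hPdecomp : a = ((P.coeff 0 : S) : κ) + u * aeval u P.divX := by
      rw [← hPa]
      conv_lhs => rw [← X_mul_divX_add P]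
      rw [map_add, map_mul, aeval_X, aeval_C]
      rw [add_comm]
      rfl
    have hP'A : aeval u P.divX ∈ A := Polynomial.aeval_mem_adjoin_singleton S u
    have hP'S' : aeval u P.divX ∈ S' := hAS' hP'A
    -- values: `v a < 1`, hence `v (P₀) < 1`
    have hva : Ō.valuation a < 1 := by
      have : a = (z : κ) * b := by rw [hzab, div_mul_cancel₀ _ hb0]
      rw [this, map_mul, hvb, mul_one]
      exact (mem_maximalIdeal_qt_iff hqt z).mp hz
    have hvuP : Ō.valuation (u * aeval u P.divX) < 1 := by
      rw [map_mul]
      have h1 : Ō.valuation (aeval u P.divX) ≤ 1 := (Ō.valuation_le_one_iff _).mpr (hqt.target_le hP'S')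
      calc Ō.valuation u * Ō.valuation (aeval u P.divX) ≤ Ō.valuation u * 1 := mul_le_mul' le_rfl h1
        _ < 1 := by rw [mul_one]; exact hlt
    have hvP0 : Ō.valuation ((P.coeff 0 : S) : κ) < 1 := by
      have e : ((P.coeff 0 : S) : κ) = a - u * aeval u P.divX := by rw [hPdecomp]; ring
      rw [e]
      exact lt_of_le_of_lt (Valuation.map_sub _ _ _) (max_lt hva hvuP)
    have hP0m : P.coeff 0 ∈ maximalIdeal S := (mem_maximalIdeal_iff_of_dominates hdom _).mpr hvP0
    rw [hm] at hP0m
    obtain ⟨c, d, hcd⟩ := Ideal.mem_span_pair.mp hP0m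
    -- assemble: `z = b⁻¹ * (c σ + d σ u + u P'(u))`
    obtain ⟨bu, hbu'⟩ := hbu
    have hzeq : z = (↑bu⁻¹ : S') * ((⟨(c : κ), hSS' c.2⟩ : S') * σ' +
        ((⟨(d : κ), hSS' d.2⟩ : S') * σ' + ⟨aeval u P.divX, hP'S'⟩) * w') := by
      have hbinv : ((↑bu⁻¹ : S') : κ) = b⁻¹ := by
        have h1 : ((bu : S') : κ) * ((↑bu⁻¹ : S') : κ) = 1 := by
          rw [← Subring.coe_mul, Units.mul_inv, Subring.coe_one]
        rw [hbu'] at h1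
        exact (eq_inv_of_mul_eq_one_right h1)
      apply Subtype.ext
      change (z : κ) = ((↑bu⁻¹ : S') : κ) * ((c : κ) * σ + ((d : κ) * σ + aeval u P.divX) * u)
      rw [hbinv, hzab, hPdecomp, ← hcd]
      push_cast
      simp only [hu]
      field_simp
      ring
    rw [hzeq]
    refine Ideal.mul_mem_left _ _ (Ideal.add_mem _ (Ideal.mul_mem_left _ _ (Ideal.subset_span (by simp)))
      (Ideal.mul_mem_left _ _ (Ideal.subset_span (by simp))))
  · rw [Ideal.span_le]
    rintro z (rfl | rfl)
    · exact hσ'm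
    · exact hw'm

end Chart

end Summit.ResolutionOfSingularities.ResolutionOfSingularities.Theorems.RadicialJung.CleanModels

end
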